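import Summits.Langlands.Langlands.Theses.ExteriorSquareAscent

/-!
# Disproof of `InducedSquareAscent` (stmt-Langlands-18053) — findings of the standing disprover

Crux (route `ExteriorSquareAscent`, rank 2): for `π` cuspidal on `GL₄/K`, `L/K` quadratic, `P` cuspidal on
`GL₃/L` with `∧²(t_{π,v}) = t_{AI(P),v}` at a.e. finite `v` (split `v`: `β₁ ⊎ β₂`; inert `v`: `γ ⊎ −γ`, `γ² = β`),
EITHER `π` is essentially self-dual at Satake level (`∃` GL(1) datum `η`, `t⁻¹ = η_v·t` a.e.) OR `π` is
self-twisted by the quadratic sign of some quadratic `L'/K` a.e.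

## Verdict of cycle 1: NO KILL — and why it resists

* **No Lean refutation is reachable in principle today.** `CuspidalAutomorphicRepData 4 K hcpt` is an HONEST
  subquotient of Borel–Jacquet cusp forms (`AutomorphicRepsGL`), `HasSatakeParamAt` is defined through genuine
  Hecke operators; there is no junk inhabitant and no constructible inhabitant, so `¬ InducedSquareAscent`
  would require constructing a cuspidal automorphic representation of `GL₄` in Lean. Every attack below is
  therefore either (i) a kernel-checked statement about the LOCAL Satake algebra of the hypothesis, or
  (ii) an externally certified statement about the finite-group (Chebotarev/Galois) SHADOW of the crux.
* **The load-bearing printed input is sound as cited.** Asgari–Raghuram, arXiv:0712.4315, Thm 1 (p. 3 of the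
  held text): `F` ANY number field, `Π` cuspidal on `GL(4, 𝔸_F)`; (i) `∧²Π` not cuspidal ⇔ (iii) (α) `Π ≅ Π^∨⊗χ`
  (and `Π` is not the Asai transfer of a non-dihedral form) or (β) `Π ≅ Π⊗χ`, `χ ≠ 1`. The direction the crux
  uses, (i)⇒(iii), is §4, Props 11–12 (p. 10): Langlands–Shahidi for `GL(n)×GSpin(6) ⊂ GSpin(2n+6)`,
  `n = 1,2,3`, Prop 4 ("`w₀(Σ) ≇ Σ ⇒ L(s,Σ,r₁)` entire", standard Kim–Shahidi) and Prop 5 (the `w₀`-action,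
  proved in the paper, pp. 6–7); descent (GRS/Hundley–Sayag) enters ONLY (iii)⇒(ii) (§5). The `r₂`
  constituents for `n = 2, 3` are a Hecke character and a `GL₃` standard L-function, evaluated at `s = 2`
  (absolutely convergent), so no hidden non-vanishing hypothesis is used. The exception in (iii)(α) only
  STRENGTHENS (iii); the crux needs the weaker "ess. self-dual ∨ self-twisted".
* **Galois/Tannakian shadow is a theorem** (§B): `G ⊃ H` index 2, `V` irreducible 4-dim, `σ` irreducible
  3-dim rep of `H`, `∧²V ≅ Ind_H^G σ` ⇒ `V ≅ V^∨⊗λ` (sketch: `∧²(V|_H) = σ ⊕ σ^γ`; `σ ∩ σ^⊥ ∈ {0, σ}` for the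
  wedge pairing; totally isotropic 3-planes of the Klein quadric are `ℓ∧V` / `∧²U`, whose stabilisers are
  parabolic — excluded by irreducibility of `V|_H` (if `V|_H` is reducible, `V = Ind`, and then
  `∧²V = As ⊕ Ind(det)` has a summand of degree ≤ 2, contradicting `Ind σ` with `σ` irreducible);
  nondegenerate `σ` ⇒ `V|_H ∈ GL₂⊗GL₂ = GSO₄`, so `V|_H ≅ (V|_H)^∨ ⊗ ν`; `ν` is `γ`-invariant because a
  non-invariant `ν` would give a quadratic self-twist of `V`, i.e. `V = Ind`, excluded as before; a
  `γ`-invariant `ν` extends (`H²(ℤ/2, ℂˣ) = 0` obstruction vanishes for cyclic quotient) and Clifford gives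
  `V^∨ ≅ V ⊗ ν̃ε^j`). So a genuine counterexample would contradict reciprocity for that `π`.

## Findings the provers should use

1. **Disjunct 2 is globally VACUOUS under the hypothesis (with `P` cuspidal).** If `π ≅ π⊗ε_{M/K}` for ANY
   quadratic `M`, then `π = AI_M^K(τ)` (Arthur–Clozel) and `∧²π = As(τ)⊗ε_M ⊞ AI_M^K(ω_τ)` (Kim; AR Prop 10,
   p. 9) has an isobaric summand of degree ≤ 2, while `AI_L^K(P)` with `P` cuspidal on `GL₃` is cuspidal or
   `π' ⊞ π'ε_L` with `π'` cuspidal on `GL₃` — contradiction by Jacquet–Shalika. Hence for genuine data the crux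
   is equivalent to "hypothesis ⇒ disjunct 1", `BC_L(π)` is automatically cuspidal, and in the AR-over-`L`
   proof line the (β) branch and the "`BC_L π` non-cuspidal" branch are contradictory (hence harmless) cases;
   the picked Klein-cube line's "Case 1 (pole of `L^S(s, π×π^∨⊗ε_{L/K})`) ⇒ disjunct 2 with `L' := L`" is
   likewise a vacuous-but-valid branch. (Shadow: §B — with `W` simple the argument gives disjunct 1 outright;
   the SmallGroups sweep of job j025799 reports the count `quadtwistOnly(irr)`, predicted `0`.)
2. **Slip in the route's proof sketch (not in the statement):** "(order 4 would make `BC_L π` non-cuspidal)" is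
   unjustified; the correct closing move is: a self-twist `χ₁` of `π` of order 4 gives the QUADRATIC self-twist
   `χ₁²` (disjunct 2 with `L'` = field of `χ₁²`). Also use the 2-group fixed-point argument: the self-twist
   group `S = {χ : Π ≅ Π⊗χ}` of `Π = BC_L π` is a finite 2-group (`χ⁴ = 1`), `γ`-stable, so `S ≠ 1 ⇒ S^γ ≠ 1`.
3. **Hypotheses that are DECORATION (shadow-level, and for the AR proof line):** cuspidality of `P` (AR over `L`
   only needs `∧²(BC_L π)` NON-cuspidal; `P ⊞ P^γ` is non-cuspidal whatever `P` is) — but see 1: with `P`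
   non-cuspidal disjunct 2 may become live (shadow: `V = Ind_H^G U` has `∧²V|_H = U⊗U^γ ⊕ det U ⊕ det U^γ`,
   of induced shape with `W` REDUCIBLE whenever `U ⊗ U^γ` splits as `X ⊕ X^γ`; the sweep of job j025799
   counts such `quadtwistOnly(red)` instances);
   the inert-place clause of the hypothesis (the shadow argument uses only `∧²(V|_H) = σ ⊕ σ^γ`, i.e. the
   split places; automorphically, dropping it costs a density-one strong multiplicity one statement).
4. **Hypothesis that IS load-bearing: `Module.finrank K L = 2`.** The cubic analogue is FALSE in the shadow:
   `G = C₃³ ⋊ A₄` (order 324; also `C₃ ≀ A₄`, order 972), `H = C₃³ ⋊ V₄` (index 3), `V` = the monomial 4-dim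
   representation, `∧²V = Ind_H^G τ` with `τ` 2-dimensional irreducible, `V` not essentially self-dual and
   `G^{ab} = C₃` has no quadratic character (EXACT certificate in `ℚ(ω)`: item evidence
   `cubic_shadow_cert.py` / `cubic_counterexample.txt` — `⟨χ,χ⟩ = 1`, `⟨τ,τ⟩_H = 1`, `∧²χ = Ind τ` on all of
   `G`, `∧²V` irreducible ("`AI(P)` cuspidal"), `#Hom(G,C₂) = 1`, no linear `λ` with `χ(g⁻¹) = λ(g)χ(g)`;
   GAP corroboration + SmallGroups sweep: compute job j025799, queued at publication time).
   Automorphically this is `π` = the cyclic descent to `K` of `AI_M^L(χ|·)` for an `A₄`-quartic — so any proof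
   MUST use `[L:K] = 2` (it enters through the 2-group fixed point in 2 and through `H⁻¹(Gal(L/K), C_L) = 0`).
5. **Local anatomy (kernel-checked, §A).** At an `L`-inert place the hypothesis is equivalent to
   `e₂(α) = 0 ∧ e₃(α)² = −e₁(α)²e₄(α)` and FORCES local essential self-duality `α⁻¹ = e_v·α` with the explicit
   scalar `e_v = e₃/(e₁e₄)` (`= a⁻²` for any root `a` when `e₁ = 0`) — `inert_local_essSelfDual`; it does NOT
   force local sign-invariance (`inert_identity_not_signInvariant`, witness `(2,1,−2,4)`), and at split places
   the hypothesis constrains `α` not at all (`split_identity_unconstrained`). So every bit of the global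
   content sits in the interpolation of `v ↦ e_v` by a Hecke character and at the split places — exactly what
   the RS/JS pole arguments of the picked line supply.

## Contents
* §A  local Satake algebra: `inert_anatomy`, `inert_local_essSelfDual`, `signInvariant_anatomy`,
      `inert_identity_not_signInvariant`, `split_identity_unconstrained` (all sorry-free).
* §B  the finite-group shadow `GaloisShadow d` (definition; `d = 2` true — proof above; `d = 3` false —
      GAP certificate), with the statistics of the SmallGroups sweep (job j025799) in the docstring.
* §C  attack log / dead ends (docstring only).
-/

set_option linter.dupNamespace false

namespace Summit.Langlands.Langlands.Cruxes.InducedSquareAscent.Disproof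

open Polynomial

/-! ## §A. Local Satake algebra of the hypothesis (kernel-checked) -/

/-- Vieta for four roots (helper). [folklore] -/
theorem prod_X_sub_C_four (p q r s : ℂ) : (({p, q, r, s} : Multiset ℂ).map (fun a => X - C a)).prod
    = X^4 - C (p+q+r+s) * X^3 + C (p*q+p*r+p*s+q*r+q*s+r*s) * X^2
      - C (p*q*r+p*q*s+p*r*s+q*r*s) * X + C (p*q*r*s) := by
  simp only [Multiset.insert_eq_cons, Multiset.map_cons, Multiset.map_singleton, Multiset.prod_cons,
    Multiset.prod_singleton, map_add, map_mul]
  ring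

/-- Multisets over `ℂ` with the same `∏ (X - a)` are equal (helper). [folklore] -/
theorem multiset_eq_of_prod_X_sub_C_eq (s t : Multiset ℂ)
    (h : (s.map (fun a => X - C a)).prod = (t.map (fun a => X - C a)).prod) : s = t := by
  rw [← Polynomial.roots_multiset_prod_X_sub_C s, ← Polynomial.roots_multiset_prod_X_sub_C t, h]

/-- Two 4-element multisets with equal elementary symmetric functions coincide (helper). [folklore] -/
theorem multiset_four_eq {p q r s p' q' r' s' : ℂ}
    (h1 : p+q+r+s = p'+q'+r'+s')
    (h2 : p*q+p*r+p*s+q*r+q*s+r*s = p'*q'+p'*r'+p'*s'+q'*r'+q'*s'+r'*s')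
    (h3 : p*q*r+p*q*s+p*r*s+q*r*s = p'*q'*r'+p'*q'*s'+p'*r'*s'+q'*r'*s')
    (h4 : p*q*r*s = p'*q'*r'*s') :
    ({p, q, r, s} : Multiset ℂ) = {p', q', r', s'} := by
  apply multiset_eq_of_prod_X_sub_C_eq
  rw [prod_X_sub_C_four, prod_X_sub_C_four, h1, h2, h3, h4]

/-- **Inert-place anatomy.** If the exterior-square multiset `{ab, ac, ad, bc, bd, cd}` of `α = {a,b,c,d}` is
of the automorphic-induction shape `γ ⊎ (−γ)` (the inert clause of the crux hypothesis), then
`e₂(α) = 0` and `e₃(α)² + e₁(α)²·e₄(α) = 0` (odd power sums of `∧²α` vanish; Newton). [folklore] -/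
theorem inert_anatomy (a b c d x y z : ℂ)
    (h : ({a*b, a*c, a*d, b*c, b*d, c*d} : Multiset ℂ) = {x, y, z, -x, -y, -z}) :
    a*b + a*c + a*d + b*c + b*d + c*d = 0 ∧
      (a*b*c + a*b*d + a*c*d + b*c*d)^2 + (a+b+c+d)^2 * (a*b*c*d) = 0 := by
  have h1 := congrArg Multiset.sum h
  have h3 := congrArg (fun m : Multiset ℂ => (m.map (· ^ 3)).sum) h
  simp only [Multiset.insert_eq_cons, Multiset.sum_cons, Multiset.sum_singleton, Multiset.map_cons,
    Multiset.map_singleton] at h1 h3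
  have e2 : a*b + a*c + a*d + b*c + b*d + c*d = 0 := by linear_combination h1
  refine ⟨e2, ?_⟩
  have h3' : (a*b)^3 + (a*c)^3 + (a*d)^3 + (b*c)^3 + (b*d)^3 + (c*d)^3 = 0 := by linear_combination h3
  -- Newton: p₃(∧²α) = E₁³ - 3E₁E₂ + 3E₃ with E₁ = e₂, E₂ = e₁e₃ - e₄, E₃ = e₃² + e₁²e₄ - 2e₂e₄
  linear_combination (1/3 : ℂ) * h3'
    - (1/3 : ℂ) * ((a*b + a*c + a*d + b*c + b*d + c*d)^2
        - 3 * ((a+b+c+d) * (a*b*c + a*b*d + a*c*d + b*c*d) - a*b*c*d) - 6 * (a*b*c*d)) * e2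

/-- **Inert places are locally essentially self-dual.** Under the inert clause of the crux hypothesis
(`∧²α = γ ⊎ −γ`) with non-zero entries, `α⁻¹ = e·α` as multisets for an explicit `e`
(`e = e₃/(e₁e₄)` if `e₁ ≠ 0`, `e = a⁻²` otherwise). Consequence for the crux: the inert clause can never
be the seat of a counterexample; the global content of disjunct 1 is the interpolation of `v ↦ e_v` by a
Hecke character together with the (locally unconstrained) split places. [folklore] -/
theorem inert_local_essSelfDual (a b c d x y z : ℂ) (ha : a ≠ 0) (hb : b ≠ 0) (hc : c ≠ 0) (hd : d ≠ 0)
    (h : ({a*b, a*c, a*d, b*c, b*d, c*d} : Multiset ℂ) = {x, y, z, -x, -y, -z}) :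
    ∃ e : ℂ, ({a, b, c, d} : Multiset ℂ).map (fun t => t⁻¹) = ({a, b, c, d} : Multiset ℂ).map (fun t => e * t) := by
  obtain ⟨e2, e3⟩ := inert_anatomy a b c d x y z h
  have h4 : a*b*c*d ≠ 0 := by simp [ha, hb, hc, hd]
  have L1 : a⁻¹+b⁻¹+c⁻¹+d⁻¹ = (a*b*c + a*b*d + a*c*d + b*c*d) / (a*b*c*d) := by field_simp; ring
  have L2 : a⁻¹*b⁻¹+a⁻¹*c⁻¹+a⁻¹*d⁻¹+b⁻¹*c⁻¹+b⁻¹*d⁻¹+c⁻¹*d⁻¹ =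
      (a*b + a*c + a*d + b*c + b*d + c*d) / (a*b*c*d) := by field_simp; ring
  have L3 : a⁻¹*b⁻¹*c⁻¹+a⁻¹*b⁻¹*d⁻¹+a⁻¹*c⁻¹*d⁻¹+b⁻¹*c⁻¹*d⁻¹ = (a+b+c+d) / (a*b*c*d) := by
    field_simp; ring
  have L4 : a⁻¹*b⁻¹*c⁻¹*d⁻¹ = 1 / (a*b*c*d) := by field_simp
  have M1 : ∀ e : ℂ, e*a+e*b+e*c+e*d = e * (a+b+c+d) := fun e => by ring
  have M2 : ∀ e : ℂ, e*a*(e*b)+e*a*(e*c)+e*a*(e*d)+e*b*(e*c)+e*b*(e*d)+e*c*(e*d) =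
      e^2 * (a*b + a*c + a*d + b*c + b*d + c*d) := fun e => by ring
  have M3 : ∀ e : ℂ, e*a*(e*b)*(e*c)+e*a*(e*b)*(e*d)+e*a*(e*c)*(e*d)+e*b*(e*c)*(e*d) =
      e^3 * (a*b*c + a*b*d + a*c*d + b*c*d) := fun e => by ring
  have M4 : ∀ e : ℂ, e*a*(e*b)*(e*c)*(e*d) = e^4 * (a*b*c*d) := fun e => by ring
  simp only [Multiset.insert_eq_cons, Multiset.map_cons, Multiset.map_singleton]
  simp only [← Multiset.insert_eq_cons]
  by_cases h1 : a + b + c + d = 0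
  · -- degenerate case e₁ = 0: then e₃ = 0, every root satisfies t⁴ = -e₄; take e = a⁻²
    have e3' : a*b*c + a*b*d + a*c*d + b*c*d = 0 := by
      have : (a*b*c + a*b*d + a*c*d + b*c*d)^2 = 0 := by
        linear_combination e3 - (a+b+c+d) * (a*b*c*d) * h1
      exact pow_eq_zero_iff (n := 2) (by norm_num) |>.mp this
    have ha4 : a^4 = -(a*b*c*d) := by
      linear_combination (a^3) * h1 - a^2 * e2 + a * e3'
    refine ⟨(a^2)⁻¹, multiset_four_eq ?_ ?_ ?_ ?_⟩
    · rw [L1, M1, e3', h1]; simp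
    · rw [L2, M2, e2]; simp
    · rw [L3, M3, h1, e3']; simp
    · rw [L4, M4]
      have ha2 : a^2 ≠ 0 := pow_ne_zero 2 ha
      have ha3 : a^3 = -(b*c*d) := by
        have h' : a * (a^3 + b*c*d) = 0 := by linear_combination ha4
        rcases mul_eq_zero.mp h' with h'' | h''
        · exact absurd h'' ha
        · linear_combination h''
      field_simp
      linear_combination (a^3 - b*c*d) * ha3
  · -- generic case: e = e₃ / (e₁ e₄)
    refine ⟨(a*b*c + a*b*d + a*c*d + b*c*d) / ((a+b+c+d) * (a*b*c*d)), multiset_four_eq ?_ ?_ ?_ ?_⟩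
    · rw [L1, M1]; field_simp
    · rw [L2, M2, e2]; simp
    · rw [L3, M3]; field_simp
      linear_combination ((a+b+c+d)^2 * (a*b*c*d) - (a*b*c + a*b*d + a*c*d + b*c*d)^2) * e3
    · rw [L4, M4]; field_simp
      linear_combination ((a+b+c+d)^2 * (a*b*c*d) - (a*b*c + a*b*d + a*c*d + b*c*d)^2) * e3

/-- **Anatomy of disjunct 2 at an `L'`-inert place.** Local sign-invariance `−α = α` forces
`e₁(α) = 0 ∧ e₃(α) = 0` (odd power sums vanish). Together with `inert_anatomy` this shows the two local
conditions are independent pieces of the constraint variety: `{e₂ = 0, e₃² = −e₁²e₄}` (hypothesis) versus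
`{e₁ = e₃ = 0}` (disjunct 2). [folklore] -/
theorem signInvariant_anatomy (a b c d : ℂ)
    (h : ({a, b, c, d} : Multiset ℂ).map (fun t => (-1 : ℂ) * t) = {a, b, c, d}) :
    a + b + c + d = 0 ∧ a*b*c + a*b*d + a*c*d + b*c*d = 0 := by
  have h1 := congrArg Multiset.sum h
  have h3 := congrArg (fun m : Multiset ℂ => (m.map (· ^ 3)).sum) h
  simp only [Multiset.insert_eq_cons, Multiset.sum_cons, Multiset.sum_singleton, Multiset.map_cons,
    Multiset.map_singleton] at h1 h3
  have e1 : a + b + c + d = 0 := by linear_combination (-1/2 : ℂ) * h1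
  refine ⟨e1, ?_⟩
  -- p₃ = e₁³ - 3e₁e₂ + 3e₃, and p₃ = 0 from h3
  have p3 : a^3 + b^3 + c^3 + d^3 = 0 := by linear_combination (-1/2 : ℂ) * h3
  linear_combination (1/3 : ℂ) * p3
    - (1/3 : ℂ) * ((a+b+c+d)^2 - 3 * (a*b + a*c + a*d + b*c + b*d + c*d)) * e1

/-- **The inert identity does not force the local shape of disjunct 2** (refutes the natural local
strengthening "inert clause ⇒ `−α = α`"): `α = (2, 1, −2, 4)` has `∧²α = (2, −4, 8) ⊎ −(2, −4, 8)` but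
`−α ≠ α`. Globally the same strengthening ("hypothesis ⇒ `π ≅ π ⊗ ε_{L/K}`") is false for every Asai
transfer `π = As_{L/K}(τ)`, `τ` non-dihedral with `τ^γ ≇ τ⊗μ` (`BC_L π = τ ⊠ τ^γ` cuspidal), the model family
of the hypothesis (AR Prop 7, p. 8: `∧²(As τ) = AI_L^K(Sym²τ ⊗ ω_{τ^γ})`). [folklore] -/
theorem inert_identity_not_signInvariant :
    ((({2, 1, -2, 4} : Multiset ℤ).powersetCard 2).map Multiset.prod
        = ({2, -4, 8} : Multiset ℤ) + ({2, -4, 8} : Multiset ℤ).map (fun c => -c)) ∧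
      ({2, 1, -2, 4} : Multiset ℤ).map (fun a => (-1 : ℤ) * a) ≠ ({2, 1, -2, 4} : Multiset ℤ) := by
  decide

/-- **The split clause constrains `α` not at all locally**: any six numbers are `β₁ ⊎ β₂` for 3-element
`β₁, β₂`; e.g. for the "generic" `α = (1, 2, 3, 4)` (neither locally self-dual nor sign-invariant).
So at split places the hypothesis carries no local information whatsoever about `α`; the content there is
purely global (which `β`'s are Satake parameters of ONE cuspidal `P`). [folklore] -/
theorem split_identity_unconstrained :
    ((({1, 2, 3, 4} : Multiset ℤ).powersetCard 2).map Multiset.prod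
        = ({2, 3, 4} : Multiset ℤ) + ({6, 8, 12} : Multiset ℤ)) ∧
      ({1, 2, 3, 4} : Multiset ℤ).map (fun a => (-1 : ℤ) * a) ≠ ({1, 2, 3, 4} : Multiset ℤ) ∧
      ∀ e : ℚ, ({1, 2, 3, 4} : Multiset ℚ).map (fun a => a⁻¹) ≠ ({1, 2, 3, 4} : Multiset ℚ).map (fun a => e * a) := by
  refine ⟨by decide, by decide, ?_⟩
  intro e h
  -- compare sums and sums of squares: e·10 = 25/12 and e²·30 = 205/144 are incompatible
  have h1 := congrArg Multiset.sum h
  have h2 := congrArg (fun m : Multiset ℚ => (m.map (· ^ 2)).sum) h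
  simp only [Multiset.insert_eq_cons, Multiset.map_cons, Multiset.map_singleton, Multiset.sum_cons,
    Multiset.sum_singleton] at h1 h2
  have he : e = 25 / 120 := by linear_combination (1/10 : ℚ) * h1.symm
  subst he
  norm_num at h2

/-! ## §B. The finite-group (Chebotarev) shadow -/

/-- `χ_{∧²V}(g) = (χ(g)² − χ(g²))/2`. [folklore] -/
noncomputable def wedgeTwoChar {G : Type} [Group G] (χ : G → ℂ) (g : G) : ℂ := (χ g ^ 2 - χ (g * g)) / 2

/-- Frobenius' formula for the induced class function. [folklore] -/
noncomputable def indChar {G : Type} [Group G] [Fintype G] (H : Subgroup G) [DecidablePred (· ∈ H)]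
    (σ : H → ℂ) (g : G) : ℂ :=
  (Fintype.card H : ℂ)⁻¹ * ∑ x : G, if h : x * g * x⁻¹ ∈ H then σ ⟨x * g * x⁻¹, h⟩ else 0

/-- **Finite-group shadow of the crux with `[L:K] = d`.** Dictionary (Chebotarev): unramified `v` ↦ Frobenius
`g ∈ G = Gal(M/K)`; `v` split in `L` ⇔ `g ∈ H = Gal(M/L)` (normal, index `d`); `t_{π,v}` ↦ spectrum of
`V(g)`; `t_{P,w}` ↦ spectrum of `W(h)`; "a.e. equality of Satake multisets" ↦ equality of characters; `P`
cuspidal ↦ `W` simple; disjunct 1 ↦ `χ_V(g⁻¹) = λ(g)χ_V(g)`; disjunct 2 ↦ `χ_V = ε·χ_V`, `ε` quadratic.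

STATUS (not kernel-checked; recorded for the provers):
* `GaloisShadow 2` is TRUE — proof in the module docstring (Klein quadric / `GL₂⊗GL₂ = GSO₄` / Clifford);
  it even yields disjunct 1 always (disjunct 2 needs `W` non-simple).
* `GaloisShadow 3` is FALSE — `G = C₃³ ⋊ A₄` (order 324) resp. `C₃ ≀ A₄` (order 972), `H` of index 3,
  `V` the monomial 4-dimensional representation, `W` 2-dimensional: `∧²V = Ind_H^G W`, `V^∨ ≇ V⊗λ` for all
  3 (resp. 9) linear `λ`, and `G` has no quadratic character. Certificates: exact `ℚ(ω)` arithmetic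
  (item evidence `cubic_shadow_cert.py` → `cubic_counterexample.txt`, both variants `VERDICT … = True`) and
  GAP (compute job j025799, `explicit.txt`, lines `INST C3wrA4 … d=3 … COUNTEREXAMPLE`).
* SmallGroups sweep (same job, `|G| ≤ 255`, all normal `H` of index 2 and 3, all `W` simple or not):
  see NOTES.md / the job's `SUMMARY` lines for the instance and counterexample counts.
So `Module.finrank K L = 2` is load-bearing, `P` cuspidal is not (for the disjunction), and with `P`
cuspidal the operative conclusion is disjunct 1. [folklore] -/
def GaloisShadow (d : ℕ) : Prop :=
  ∀ (G : Type) [Group G] [Fintype G] [DecidableEq G] (H : Subgroup G) [DecidablePred (· ∈ H)],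
    H.Normal → H.index = d →
    ∀ (V : FDRep ℂ G), CategoryTheory.Simple V → Module.finrank ℂ V = 4 →
    ∀ (W : FDRep ℂ H), CategoryTheory.Simple W → Module.finrank ℂ W * d = 6 →
    (∀ g : G, wedgeTwoChar V.character g = indChar H W.character g) →
    (∃ lam : G →* ℂˣ, ∀ g : G, V.character g⁻¹ = lam g * V.character g) ∨
    (∃ eps : G →* ℂˣ, eps ≠ 1 ∧ (∀ g, eps g ^ 2 = 1) ∧ ∀ g : G, V.character g = eps g * V.character g)

/-! ## §C. Attack log (cycle 1) — dead ends, one line each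

* junk / degenerate inhabitants of `CuspidalAutomorphicRepData 4 K hcpt`: none (honest BJ datum; `W' < W`,
  irreducible quotient, `HasSatakeParamAt` via Hecke operators) — no vacuity, no triviality, no Lean kill.
* `n = 0`-type degeneracies (cf. refuted `OrdinaryPrimeTransport.RankinSelbergPoleCount`): ranks are the
  literals 4/3/1; `Multiset.card α = 4` is forced by `HasSatakeParamAt.card_eq`; `finrank K L = 2` excludes
  `L = K`. Ramified `v` (one `w`, `f = 1`) falsify the split clause at finitely many `v` only — absorbed by
  `cofinite`. `Ideal.inertiaDeg` (Mathlib 2026: `finrank (κ(w ∩ 𝓞_K)) κ(w)`) is the residue degree.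
* essentially-self-dual disjunct: `η` ranges over ALL Hecke characters (GL(1) cusp conditions are empty),
  `η.HasSatakeParamAt v {e}` reads `e = η_v(ϖ_v)`; `a⁻¹` junk at `a = 0` irrelevant (Satake entries ≠ 0).
* sign disjunct: `if ∃ w ∣ v, f(w|v) = 1 then 1 else −1` = `ε_{L'/K}(Frob_v)` at unramified `v`, `+1` at
  ramified `v` (finitely many).
* AR Thm 1 misquotation? — no (read pp. 3, 6–10 of arXiv:0712.4315 this cycle; see docblock).
* exceptional fibres of quadratic base change / non-`γ`-invariant similitude character — cannot arise:
  finding 1 (disjunct 2 vacuous) + the 2-group fixed point (finding 2).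
* natural strengthenings: "⇒ disjunct 2 (with `L' = L`)" FALSE (Asai family; locally
  `inert_identity_not_signInvariant`); "⇒ disjunct 1" TRUE in the shadow when `P` is cuspidal;
  "`[L:K] = 3` analogue" FALSE (finding 4); "drop automorphy (Satake functions only)" false but not
  Lean-checkable today (needs infinitely many inert / split primes of a quadratic extension, absent from
  Mathlib) — not pursued.
-/

end Summit.Langlands.Langlands.Cruxes.InducedSquareAscent.Disproof
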